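import Mathlib
import HarnessLib
import Summits.NavierStokesRegularity.NavierStokesRegularity.Theorems.ChiralWindowDoorDefs
import Summits.NavierStokesRegularity.NavierStokesRegularity.Theorems.ChiralWindowDoorZoomCommutes
import Summits.NavierStokesRegularity.NavierStokesRegularity.Theorems.ChiralWindowDoorBinderFree
import Summits.NavierStokesRegularity.NavierStokesRegularity.Theorems.ChiralWindowDoorK1BinderFree
import Summits.NavierStokesRegularity.NavierStokesRegularity.Theorems.ChiralWindowDoorChiralProfileRigidity
import Summits.NavierStokesRegularity.NavierStokesRegularity.Theorems.ChiralWindowDoorLocalPointZoomLambdaSlices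
import Summits.NavierStokesRegularity.NavierStokesRegularity.Theorems.PlaneStrainDoorZoomSpaceTimeDecay

/-!
# Door S20 «ChiralWindowDoor» — THE ZOOM CRUX K1 `LocalPointZoomChiralWindow` PROVED, and THE DOOR `Target` PROVED

Door S20 of nsreg-p1's local Type-I door family (`HOME/ns-regularity-ideate-p1/ROUND-19.md`, texts `r19/Sketch20v5.lean`
7f13084196f4f031 / binder-free `r19/Sketch20v6.lean`; DESIGN-ONLY, route NOT born).  With K2 `ChiralProfileRigidity` a
tree theorem (`…ChiralWindowDoorChiralProfileRigidity.chiralProfileRigidity`), the door's open content was K1: the local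
CKN point zoom at a locally space–time Type-I point must pass the NON-LOCAL window functional
`∫_U ‖(T−t)·(curl u − Λu)(x₀ + √(T−t)y)‖ dy` to the limit.  This file does it:

* `energy_bound_of_isLerayHopfOn` — the uniform `L²` bound `∫‖u(t)‖² ≤ ∫‖u(0)‖²` on `[0,T)` (Leray–Hopf energy inequality,
  unforced), the far-field input of the `Λ`-zoom;
* `stronglyMeasurable_fracLapHalf` — measurability of `x ↦ Λ f(x)` for continuous `f` (Fatou needs it);
* `windowFatou_chiral` — **the window glue for the chirality defect**: along the zoom of
  `…LocalPointZoomLambdaSlices.localPointZoomVelGradLambdaSlices` (velocities, gradients AND `Λ` of the slices converge), the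
  window scalar `‖(T−tⱼ)·(curl u(tⱼ) − Λu(tⱼ))(x₀ + √(T−tⱼ)y)‖` converges pointwise to `σ²ν‖curl v(s) − Λv(s)‖(σy)`
  (`σ = √(−s)/√ν`; `Λ` is 1-homogeneous under the zoom, `…ZoomCommutes.fracLapHalf_smul_stPull`), so Fatou and the fading
  hypothesis give `curl v(s) = Λ v(s)` on the window `σ • U` (continuity of `Λ(v s)`: `…BinderFree.continuous_fracLapHalf_of_class`);
* `localPointZoomChiralWindow_noBinder`, `localPointZoomChiralWindow` — **crux K1 (rank 3) `LocalPointZoomChiralWindow`,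
  binder-free v6 text and v5 text (verbatim over the tree substrate), PROVED**;
* `target` — **the door: target (rank 0) `Target` of `r19/Sketch20v5.lean` (text verbatim; identical in v6), PROVED**
  (`…ChiralProfileRigidity.target_of_K1 localPointZoomChiralWindow`): a classical Leray–Hopf flow from rapidly decaying
  data that is LOCALLY SPACE–TIME TYPE I at `(x₀,T)` and whose scale-normalised CHIRALITY DEFECT `(T−t)(curl − Λ)u`
  fades in `L¹` on ONE nonempty open similarity window is backward bounded at `x₀`.

Seat nsreg-p6 g12 (THEOREMS-ONLY door sequels, DIRECTOR-NS g8 #32 (2)/#36); door texts by nsreg-p1 g16/g17.  WHAT THIS IS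
NOT: not NS regularity (Clay A) — a ONE-POINT regularity criterion under a LOCAL SPACE–TIME TYPE-I hypothesis plus a
codimension-∞ fading condition (window chirality); it does not touch the hard core (general Type-I exclusion); no route is
opened, no ledger item closed.
-/

noncomputable section

-- the summit and its single sub-problem share the name (CONVENTIONS §1), as in every Theorems file
set_option linter.dupNamespace false

namespace Summit.NavierStokesRegularity.NavierStokesRegularity.Theorems.ChiralWindowDoorTarget

open MeasureTheory Set Function Filter Topology TopologicalSpace Metric
open scoped RealInnerProductSpace InnerProductSpace NNReal ENNReal
open Literature.Analysis Literature.Analysis.FluidPDE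
open Summit.NavierStokesRegularity.NavierStokesRegularity.Theorems.ChiralWindowDoorDefs
open Summit.NavierStokesRegularity.NavierStokesRegularity.Theorems.ChiralWindowDoorZoomCommutes (fracLapHalf_smul_stPull)
open Summit.NavierStokesRegularity.NavierStokesRegularity.Theorems.ChiralWindowDoorBinderFree (continuous_fracLapHalf_of_class)
open Summit.NavierStokesRegularity.NavierStokesRegularity.Theorems.ChiralWindowDoorK1BinderFree
  (localPointZoomChiralWindow_of_noBinder)
open Summit.NavierStokesRegularity.NavierStokesRegularity.Theorems.ChiralWindowDoorChiralProfileRigidity (target_of_K1)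
open Summit.NavierStokesRegularity.NavierStokesRegularity.Theorems.ChiralWindowDoorLocalPointZoomLambdaSlices
  (localPointZoomVelGradLambdaSlices)
open Summit.NavierStokesRegularity.NavierStokesRegularity.Theorems.PlaneStrainDoorZoomSpaceTimeDecay
  (hasTypeIDecay_of_zoom timeTypeI_of_spaceTimeTypeI)
open Summit.NavierStokesRegularity.NavierStokesRegularity.Theorems.LocalSineTubeDoorProfileAlignedWindowRigidityAncient
  (analyticOnNhd_slice bdd_of_hasTypeITimeDecay)

/-! ### Two inputs: the Leray–Hopf energy bound and the measurability of `Λ f` -/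

/-- **Uniform `L²` bound of an unforced Leray–Hopf flow**: `∫‖u(t)‖² ≤ ∫‖u(0)‖²` and `‖u(t)‖²` integrable, `t ∈ [0,T)`. -/
theorem energy_bound_of_isLerayHopfOn {ν T : ℝ} (hν : 0 < ν)
    {u : ℝ → EuclideanSpace ℝ (Fin 3) → EuclideanSpace ℝ (Fin 3)} (hLH : IsLerayHopfOn T ν 0 (u 0) u) :
    ∀ t ∈ Ico 0 T, Integrable (fun x => ‖u t x‖ ^ 2) ∧ ∫ x, ‖u t x‖ ^ 2 ≤ ∫ x, ‖u 0 x‖ ^ 2 := by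
  intro t ht
  have htc : t ∈ Icc 0 T := ⟨ht.1, ht.2.le⟩
  have hmem := hLH.memLp t htc
  have hint : Integrable (fun x => ‖u t x‖ ^ 2) := (memLp_two_iff_integrable_sq_norm hmem.1).1 hmem
  refine ⟨hint, ?_⟩
  obtain ⟨G, -, -, hen, -⟩ := hLH.weakGrad_energy
  have h := hen t htc
  have hdiss : 0 ≤ ν * (∫⁻ τ in Ioo 0 t, ∫⁻ x, ENNReal.ofReal (frobeniusNormSq (G τ x))).toReal :=
    mul_nonneg hν.le ENNReal.toReal_nonneg
  have hforce : ∫ τ in (0 : ℝ)..t, ∫ x, ⟪(0 : ℝ → EuclideanSpace ℝ (Fin 3) → EuclideanSpace ℝ (Fin 3)) τ x, u τ x⟫ = 0 := by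
    simp
  rw [hforce, add_zero] at h
  unfold VectorCalculus.kineticEnergy at h
  linarith

/-- `x ↦ Λ f (x)` is strongly measurable for a continuous field (parametric Bochner integral of a jointly measurable
integrand; Fatou on the window needs it). -/
theorem stronglyMeasurable_fracLapHalf {f : EuclideanSpace ℝ (Fin 3) → EuclideanSpace ℝ (Fin 3)} (hf : Continuous f) :
    StronglyMeasurable (fracLapHalf f) := by
  have hF : StronglyMeasurable (uncurry fun (x z : EuclideanSpace ℝ (Fin 3)) =>
      lamK z • ((2 : ℝ) • f x - f (x + z) - f (x - z))) := by
    refine Measurable.stronglyMeasurable ?_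
    exact (measurable_lamK.comp measurable_snd).smul
      ((((hf.comp continuous_fst).const_smul (2 : ℝ)).sub (hf.comp (continuous_fst.add continuous_snd))).sub
        (hf.comp (continuous_fst.sub continuous_snd))).measurable
  exact (hF.integral_prod_right (ν := (volume : Measure (EuclideanSpace ℝ (Fin 3))))).const_smul (1 / 2 : ℝ)

/-! ### The window glue for the chirality defect -/

/-- **Window glue (Fatou on one similarity window) for the chirality defect.**  Along zoom data at `x₀` in the sense of
`localPointZoomVelGradLambdaSlices` (velocities, gradients and `Λ` of the slices converge pointwise to those of a
door-class profile `v`), if the window scalar `‖(T−t)·(curl u(t) − Λu(t))(x₀ + √(T−t)y)‖` fades in `L¹(U)` as `t → T⁻`,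
then for every `s < 0` and `y ∈ U`: `curl (v s) (σ • y) = fracLapHalf (v s) (σ • y)`, `σ = √(−s)/√ν`. -/
theorem windowFatou_chiral {ν T : ℝ} (hν : 0 < ν) (hT : 0 < T)
    {u : ℝ → EuclideanSpace ℝ (Fin 3) → EuclideanSpace ℝ (Fin 3)} {p : ℝ → EuclideanSpace ℝ (Fin 3) → ℝ}
    (hcl : IsClassicalNSSolutionOn (Ico 0 T) ν 0 u p) {x₀ : EuclideanSpace ℝ (Fin 3)}
    {C D : ℝ} {v : ℝ → EuclideanSpace ℝ (Fin 3) → EuclideanSpace ℝ (Fin 3)} {lam : ℕ → ℝ}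
    (hlam : ∀ j, 0 < lam j) (hlam0 : Tendsto lam atTop (𝓝 0))
    (hrate : HasTypeITimeDecay C v) (hdecay : HasTypeIDecay D v) (hcont : ContinuousOn (uncurry v) (Iio (0 : ℝ) ×ˢ univ))
    (hmild : ∀ s t : ℝ, s < t → t < 0 → ∀ x,
      v t x = UnboundedOperators.heatExtension (v s) (t - s) x - oseenDuhamel 1 s v v t x)
    (hdiv : ∀ t < 0, VectorCalculus.IsDivFree (v t))
    (hconv : ∀ s < 0, ∀ y,
      Tendsto (fun j => (lam j / ν) • u (T + lam j ^ 2 * s / ν) (x₀ + lam j • y)) atTop (𝓝 (v s y)) ∧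
      Tendsto (fun j => (lam j ^ 2 / ν) • fderiv ℝ (u (T + lam j ^ 2 * s / ν)) (x₀ + lam j • y)) atTop
        (𝓝 (fderiv ℝ (v s) y)) ∧
      Tendsto (fun j => fracLapHalf (fun y' => (lam j / ν) • u (T + lam j ^ 2 * s / ν) (x₀ + lam j • y')) y)
        atTop (𝓝 (fracLapHalf (v s) y)))
    {U : Set (EuclideanSpace ℝ (Fin 3))} (hU : IsOpen U)
    (hfade : Tendsto (fun t => ∫⁻ y in U, ENNReal.ofReal ‖(T - t) • (curl (u t) (x₀ + Real.sqrt (T - t) • y) -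
      fracLapHalf (u t) (x₀ + Real.sqrt (T - t) • y))‖) (𝓝[<] T) (𝓝 0))
    {s : ℝ} (hs : s < 0) {y : EuclideanSpace ℝ (Fin 3)} (hy : y ∈ U) :
    curl (v s) ((Real.sqrt (-s) / Real.sqrt ν) • y) = fracLapHalf (v s) ((Real.sqrt (-s) / Real.sqrt ν) • y) := by
  -- ## zoom times `tⱼ = T + λⱼ² s/ν → T⁻`
  have hns : 0 < -s := neg_pos.2 hs
  obtain ⟨t, ht⟩ : ∃ t : ℕ → ℝ, ∀ j, t j = T + lam j ^ 2 * s / ν := ⟨_, fun j => rfl⟩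
  have hTt : ∀ j, T - t j = lam j ^ 2 * (-s) / ν := fun j => by rw [ht j]; ring
  have hc : ∀ j, 0 < lam j ^ 2 * (-s) / ν := fun j => div_pos (mul_pos (pow_pos (hlam j) 2) hns) hν
  have hc0 : Tendsto (fun j => lam j ^ 2 * (-s) / ν) atTop (𝓝 0) := by
    simpa using ((hlam0.pow 2).mul_const (-s)).div_const ν
  have htT : Tendsto t atTop (𝓝[<] T) := by
    refine tendsto_nhdsWithin_iff.2 ⟨?_, Eventually.of_forall fun j => ?_⟩
    · have h1 : Tendsto (fun j => T - lam j ^ 2 * (-s) / ν) atTop (𝓝 (T - 0)) :=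
        tendsto_const_nhds.sub hc0
      rw [sub_zero] at h1
      refine h1.congr fun j => ?_
      rw [ht j]; ring
    · show t j < T
      have h1 := hc j
      rw [← hTt j] at h1
      linarith
  have hev : ∀ᶠ j in atTop, t j ∈ Set.Ioo 0 T := htT.eventually (Ioo_mem_nhdsLT hT)
  obtain ⟨j₀, hj₀⟩ := eventually_atTop.1 hev
  have hshift : Tendsto (fun j : ℕ => j + j₀) atTop atTop := tendsto_add_atTop_nat j₀
  -- the window scalars along the shifted zoom times (named, to keep terms small)
  obtain ⟨Φ, hΦ⟩ : ∃ Φ : ℕ → EuclideanSpace ℝ (Fin 3) → ℝ, ∀ j y, Φ j y = ‖(T - t (j + j₀)) •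
      (curl (u (t (j + j₀))) (x₀ + Real.sqrt (T - t (j + j₀)) • y) -
        fracLapHalf (u (t (j + j₀))) (x₀ + Real.sqrt (T - t (j + j₀)) • y))‖ := ⟨_, fun _ _ => rfl⟩
  have hfadej : Tendsto (fun j => ∫⁻ y in U, ENNReal.ofReal (Φ j y)) atTop (𝓝 0) := by
    have h := (hfade.comp htT).comp hshift
    simpa only [Function.comp_def, hΦ] using h
  -- ## the similarity scale along the zoom: `√(T − tⱼ) = λⱼ σ`, `σ = √(−s)/√ν`
  set σ : ℝ := Real.sqrt (-s) / Real.sqrt ν with hσ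
  have hσpos : 0 < σ := div_pos (Real.sqrt_pos.2 hns) (Real.sqrt_pos.2 hν)
  have hsq : ∀ j, Real.sqrt (T - t j) = lam j * σ := by
    intro j
    rw [hTt j, hσ, Real.sqrt_div' _ hν.le, Real.sqrt_mul (pow_nonneg (hlam j).le 2),
      Real.sqrt_sq (hlam j).le]
    ring
  have hTt' : ∀ j, T - t j = σ ^ 2 * ν * (lam j ^ 2 / ν) := by
    intro j
    rw [hTt j, hσ, div_pow, Real.sq_sqrt hns.le, Real.sq_sqrt hν.le]
    field_simp
  -- window curl and window `Λ` at time `tⱼ` versus the rescaled gradient / `Λ` at `σ y`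
  have hcurl : ∀ (j : ℕ) (y : EuclideanSpace ℝ (Fin 3)),
      (T - t (j + j₀)) • curl (u (t (j + j₀))) (x₀ + Real.sqrt (T - t (j + j₀)) • y) =
        curlCLM ((σ ^ 2 * ν) • ((lam (j + j₀) ^ 2 / ν) • fderiv ℝ (u (T + lam (j + j₀) ^ 2 * s / ν))
          (x₀ + lam (j + j₀) • (σ • y)))) := by
    intro j y
    rw [curl_eq_curlCLM, ← map_smul, ← ht (j + j₀), hsq (j + j₀), hTt' (j + j₀)]
    simp only [smul_smul]
  have hL : ∀ (j : ℕ) (y : EuclideanSpace ℝ (Fin 3)),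
      (T - t (j + j₀)) • fracLapHalf (u (t (j + j₀))) (x₀ + Real.sqrt (T - t (j + j₀)) • y) =
        (σ ^ 2 * ν) • fracLapHalf (fun y' => (lam (j + j₀) / ν) • u (T + lam (j + j₀) ^ 2 * s / ν)
          (x₀ + lam (j + j₀) • y')) (σ • y) := by
    intro j y
    have hz := fracLapHalf_smul_stPull (lam (j + j₀) / ν) (lam (j + j₀) ^ 2 / ν) (lam (j + j₀)) T
      (hlam (j + j₀)) x₀ u s (σ • y)
    have e1 : ((lam (j + j₀) / ν) • stPull (lam (j + j₀) ^ 2 / ν) (lam (j + j₀)) T x₀ u) s =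
        fun y' => (lam (j + j₀) / ν) • u (T + lam (j + j₀) ^ 2 * s / ν) (x₀ + lam (j + j₀) • y') := by
      funext y'
      rw [smul_stPull_apply]
      congr 2
      ring
    have e2 : T + lam (j + j₀) ^ 2 / ν * s = t (j + j₀) := by rw [ht]; ring
    rw [e1, e2, smul_smul] at hz
    rw [hsq (j + j₀), hz, smul_smul, hTt' (j + j₀)]
    congr 1
    ring
  -- ## the limit scalar in window coordinates and its continuity
  have han : AnalyticOnNhd ℝ (v s) univ := analyticOnNhd_slice hcont (bdd_of_hasTypeITimeDecay hrate) hmild hs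
  have hcurlc : Continuous (curl (v s)) := by
    rw [curl_eq_curlCLM_comp]
    exact curlCLM.continuous.comp ((han.contDiff (n := 1)).continuous_fderiv one_ne_zero)
  have hΛc : Continuous (fracLapHalf (v s)) := continuous_fracLapHalf_of_class hrate hdecay hcont hmild hdiv hs
  obtain ⟨Hs, hHs⟩ : ∃ Hs : EuclideanSpace ℝ (Fin 3) → ℝ, ∀ y,
      Hs y = ‖(σ ^ 2 * ν) • (curl (v s) (σ • y) - fracLapHalf (v s) (σ • y))‖ := ⟨_, fun _ => rfl⟩
  have h1c : Continuous fun y : EuclideanSpace ℝ (Fin 3) => curl (v s) (σ • y) := hcurlc.comp (continuous_const_smul σ)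
  have h2c : Continuous fun y : EuclideanSpace ℝ (Fin 3) => fracLapHalf (v s) (σ • y) :=
    hΛc.comp (continuous_const_smul σ)
  have hHscont : Continuous Hs := by
    have h := ((h1c.sub h2c).const_smul (σ ^ 2 * ν)).norm
    refine h.congr fun y => ?_
    rw [hHs]; rfl
  -- ## pointwise convergence of the window scalars
  have hconvH : ∀ y, Tendsto (fun j => Φ j y) atTop (𝓝 (Hs y)) := by
    intro y
    have hg : Tendsto (fun j => (σ ^ 2 * ν) • ((lam (j + j₀) ^ 2 / ν) •
        fderiv ℝ (u (T + lam (j + j₀) ^ 2 * s / ν)) (x₀ + lam (j + j₀) • (σ • y)))) atTop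
        (𝓝 ((σ ^ 2 * ν) • fderiv ℝ (v s) (σ • y))) :=
      (((hconv s hs (σ • y)).2.1).comp hshift).const_smul (σ ^ 2 * ν)
    have hg' := (curlCLM.continuous.tendsto _).comp hg
    rw [Function.comp_def, map_smul, ← curl_eq_curlCLM] at hg'
    have hl : Tendsto (fun j => (σ ^ 2 * ν) • fracLapHalf (fun y' => (lam (j + j₀) / ν) •
        u (T + lam (j + j₀) ^ 2 * s / ν) (x₀ + lam (j + j₀) • y')) (σ • y)) atTop
        (𝓝 ((σ ^ 2 * ν) • fracLapHalf (v s) (σ • y))) :=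
      (((hconv s hs (σ • y)).2.2).comp hshift).const_smul (σ ^ 2 * ν)
    have h := (hg'.sub hl).norm
    rw [← smul_sub, ← hHs] at h
    refine h.congr fun j => ?_
    rw [hΦ, smul_sub, hcurl j y, hL j y]
  -- measurability of the window scalars
  have hmem : ∀ j, t (j + j₀) ∈ Set.Ico 0 T := fun j =>
    ⟨(hj₀ (j + j₀) (Nat.le_add_left _ _)).1.le, (hj₀ (j + j₀) (Nat.le_add_left _ _)).2⟩
  have hφ : ∀ j, Continuous fun y : EuclideanSpace ℝ (Fin 3) => x₀ + Real.sqrt (T - t (j + j₀)) • y :=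
    fun j => continuous_const.add (continuous_const_smul _)
  have hFjm : ∀ j, AEStronglyMeasurable (Φ j) volume := by
    intro j
    have hu : Continuous (u (t (j + j₀))) := (hcl.contDiff_velocity (hmem j)).continuous
    have hcu : Continuous (curl (u (t (j + j₀)))) := by
      rw [curl_eq_curlCLM_comp]
      exact curlCLM.continuous.comp ((hcl.contDiff_velocity (hmem j)).continuous_fderiv (by norm_cast))
    have h1 : AEStronglyMeasurable (fun y => curl (u (t (j + j₀))) (x₀ + Real.sqrt (T - t (j + j₀)) • y)) volume :=
      (hcu.comp (hφ j)).aestronglyMeasurable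
    have h2 : AEStronglyMeasurable (fun y => fracLapHalf (u (t (j + j₀))) (x₀ + Real.sqrt (T - t (j + j₀)) • y)) volume :=
      ((stronglyMeasurable_fracLapHalf hu).comp_measurable (hφ j).measurable).aestronglyMeasurable
    have h := ((h1.sub h2).const_smul (T - t (j + j₀))).norm
    refine h.congr (Eventually.of_forall fun y => ?_)
    simp only [Pi.smul_apply, Pi.sub_apply, hΦ]
  -- ## FATOU: the faded scalar vanishes on the window in the limit
  set g : EuclideanSpace ℝ (Fin 3) → ℝ≥0∞ := fun y => ENNReal.ofReal (Hs y) with hg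
  have hgc : Continuous g := ENNReal.continuous_ofReal.comp hHscont
  have hptw : ∀ y, Tendsto (fun j => ENNReal.ofReal (Φ j y)) atTop (𝓝 (g y)) :=
    fun y => ENNReal.tendsto_ofReal (hconvH y)
  have hFatou : ∫⁻ y in U, liminf (fun j => ENNReal.ofReal (Φ j y)) atTop ≤
      liminf (fun j => ∫⁻ y in U, ENNReal.ofReal (Φ j y)) atTop :=
    lintegral_liminf_le' fun j => (ENNReal.measurable_ofReal.comp_aemeasurable (hFjm j).aemeasurable).restrict
  have hlim : (fun y => liminf (fun j => ENNReal.ofReal (Φ j y)) atTop) = g :=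
    funext fun y => (hptw y).liminf_eq
  rw [hlim, hfadej.liminf_eq] at hFatou
  have hint : ∫⁻ y in U, g y = 0 := le_antisymm hFatou bot_le
  have hae : ∀ᵐ y ∂(volume.restrict U), g y = 0 := (lintegral_eq_zero_iff hgc.measurable).1 hint
  rw [ae_restrict_iff' hU.measurableSet] at hae
  have hzero : ∀ y ∈ U, g y = 0 := by
    intro y hy
    by_contra hne
    set O : Set (EuclideanSpace ℝ (Fin 3)) := U ∩ g ⁻¹' (Ioi 0) with hO
    have hOo : IsOpen O := hU.inter (isOpen_Ioi.preimage hgc)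
    have hO0 : volume O = 0 := by
      rw [measure_eq_zero_iff_ae_notMem]
      filter_upwards [hae] with y' hy'
      rintro ⟨h1, h2⟩
      have := hy' h1
      simp only [mem_preimage, mem_Ioi, this, lt_self_iff_false] at h2
    have hOe : O = ∅ := (hOo.measure_eq_zero_iff volume).1 hO0
    have hyO : y ∈ O := ⟨hy, by simpa [mem_preimage, mem_Ioi, pos_iff_ne_zero] using hne⟩
    rw [hOe] at hyO
    exact hyO
  have h := hzero y hy
  simp only [hg, ENNReal.ofReal_eq_zero] at h
  have h0 : Hs y = 0 := le_antisymm h (by rw [hHs]; exact norm_nonneg _)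
  rw [hHs, norm_smul, mul_eq_zero] at h0
  rcases h0 with h0 | h0
  · exfalso
    rw [Real.norm_eq_abs, abs_eq_zero] at h0
    have : 0 < σ ^ 2 * ν := by positivity
    exact this.ne' h0
  · exact sub_eq_zero.1 (norm_eq_zero.1 h0)

/-! ### K1 and the door -/

/-- **Crux K1 (rank 3) `LocalPointZoomChiralWindow` of nsreg-p1 `r19/Sketch20v6.lean` (binder-free text, verbatim over the
tree substrate), PROVED.**  At a locally space–time Type-I point of a classical Leray–Hopf flow from rapidly decaying
data whose scale-normalised chirality defect fades in `L¹` on one nonempty open similarity window, if the point is NOT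
backward bounded the parabolic point zoom produces a door-class profile (Type-I time rate, space–time Type-I decay,
continuity on the open backward slab, unit-viscosity Oseen–Duhamel identity, divergence-free slices) which is
backward-singular at the apex and CHIRAL (`curl v(s) = Λ v(s)`) on a nonempty open window of every slice. -/
theorem localPointZoomChiralWindow_noBinder : ∀ (ν T : ℝ), 0 < ν → 0 < T → ∀ (u : ℝ → EuclideanSpace ℝ (Fin 3) → EuclideanSpace ℝ (Fin 3)) (p : ℝ → EuclideanSpace ℝ (Fin 3) → ℝ), Literature.Analysis.FluidPDE.IsClassicalNSSolutionOn (Set.Ico 0 T) ν 0 u p → Literature.Analysis.FluidPDE.IsLerayHopfOn T ν 0 (u 0) u → Literature.Analysis.FluidPDE.HasRapidSpatialDecay (u 0) → ∀ (x₀ : EuclideanSpace ℝ (Fin 3)) (ρ M : ℝ), 0 < ρ → (∀ t ∈ Set.Ico 0 T, T - ρ ^ 2 < t → ∀ x ∈ Metric.ball x₀ ρ, ‖u t x‖ * (‖x - x₀‖ + Real.sqrt (ν * (T - t))) ≤ M) → ∀ (U : Set (EuclideanSpace ℝ (Fin 3))), IsOpen U → U.Nonempty → Filter.Tendsto (fun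 t => ∫⁻ y in U, ENNReal.ofReal ‖(T - t) • (Literature.Analysis.FluidPDE.curl (u t) (x₀ + Real.sqrt (T - t) • y) - Summit.NavierStokesRegularity.NavierStokesRegularity.Theorems.ChiralWindowDoorDefs.fracLapHalf (u t) (x₀ + Real.sqrt (T - t) • y))‖) (nhdsWithin T (Set.Iio T)) (nhds 0) → ¬ Literature.Analysis.FluidPDE.IsBackwardBoundedAt u T x₀ → ∃ (C D : ℝ) (v : ℝ → EuclideanSpace ℝ (Fin 3) → EuclideanSpace ℝ (Fin 3)), Literature.Analysis.FluidPDE.HasTypeITimeDecay C v ∧ Literature.Analysis.FluidPDE.HasTypeIDecay D v ∧ ContinuousOn (Function.uncurry v) (Set.Iio (0 : ℝ) ×ˢ Set.univ) ∧ (∀ s t : ℝ, s < t → t < 0 → ∀ x, v t x = Literature.Analysis.UnboundedOperators.heatExtension (v s) (t - s) x - Literature.Analysis.FluidPDE.oseenDuhamel 1 s v v t x) ∧ (∀ t < 0, Literature.Analysis.FluidPDE.VectorCalculus.IsDivFree (v t)) ∧ Literature.Analysis.FluidPDE.IsBackwardSingularPoint v 0 ∧ (∀ s < 0, ∃ U :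 Set (EuclideanSpace ℝ (Fin 3)), IsOpen U ∧ U.Nonempty ∧ ∀ z ∈ U, Literature.Analysis.FluidPDE.curl (v s) z = Summit.NavierStokesRegularity.NavierStokesRegularity.Theorems.ChiralWindowDoorDefs.fracLapHalf (v s) z) := by
  intro ν T hν hT u p hcl hLH hdec x₀ ρ M hρ hM U hU hUne hfade hnot
  have hEn := energy_bound_of_isLerayHopfOn hν hLH
  obtain ⟨C, v, lam, hlam, hlam0, ⟨hrate, hcont, hmild, hdiv⟩, hsing, hconv⟩ :=
    localPointZoomVelGradLambdaSlices hν hT hcl hLH hEn hρ (timeTypeI_of_spaceTimeTypeI hM) hnot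
  have hdecay : HasTypeIDecay (M / ν) v :=
    hasTypeIDecay_of_zoom hν hT hρ hlam hlam0 hM fun s hs y => (hconv s hs y).1
  refine ⟨C, M / ν, v, hrate, hdecay, hcont, hmild, hdiv, hsing, fun s hs => ?_⟩
  have hns : 0 < -s := neg_pos.2 hs
  set σ : ℝ := Real.sqrt (-s) / Real.sqrt ν with hσ
  have hσpos : 0 < σ := div_pos (Real.sqrt_pos.2 hns) (Real.sqrt_pos.2 hν)
  refine ⟨(fun z => σ⁻¹ • z) ⁻¹' U, hU.preimage (continuous_const_smul σ⁻¹), ?_, fun z hz => ?_⟩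
  · obtain ⟨u₀, hu₀⟩ := hUne
    refine ⟨σ • u₀, ?_⟩
    show σ⁻¹ • (σ • u₀) ∈ U
    rwa [smul_smul, inv_mul_cancel₀ hσpos.ne', one_smul]
  · have h := windowFatou_chiral hν hT hcl hlam hlam0 hrate hdecay hcont hmild hdiv hconv hU hfade hs hz
    rwa [smul_smul, mul_inv_cancel₀ hσpos.ne', one_smul] at h

/-- **Crux K1 (rank 3) `LocalPointZoomChiralWindow` of nsreg-p1 `r19/Sketch20v5.lean` (text verbatim over the tree
substrate, with the R19 binder in the conclusion), PROVED** (`…K1BinderFree.localPointZoomChiralWindow_of_noBinder`). -/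
theorem localPointZoomChiralWindow : ∀ (ν T : ℝ), 0 < ν → 0 < T → ∀ (u : ℝ → EuclideanSpace ℝ (Fin 3) → EuclideanSpace ℝ (Fin 3)) (p : ℝ → EuclideanSpace ℝ (Fin 3) → ℝ), Literature.Analysis.FluidPDE.IsClassicalNSSolutionOn (Set.Ico 0 T) ν 0 u p → Literature.Analysis.FluidPDE.IsLerayHopfOn T ν 0 (u 0) u → Literature.Analysis.FluidPDE.HasRapidSpatialDecay (u 0) → ∀ (x₀ : EuclideanSpace ℝ (Fin 3)) (ρ M : ℝ), 0 < ρ → (∀ t ∈ Set.Ico 0 T, T - ρ ^ 2 < t → ∀ x ∈ Metric.ball x₀ ρ, ‖u t x‖ * (‖x - x₀‖ + Real.sqrt (ν * (T - t))) ≤ M) → ∀ (U : Set (EuclideanSpace ℝ (Fin 3))), IsOpen U → U.Nonempty → Filter.Tendsto (fun t => ∫⁻ y in U, ENNReal.ofReal ‖(T - t) • (curl (u t) (x₀ + Real.sqrt (T - t) • y) - fracLapHalf (u t) (x₀ + Real.sqrt (T - t) • y))‖) (nhdsWithin T (Set.Iio T)) (nhds 0) → ¬ Literature.Analysis.FluidPDE.IsBackwardBoundedAt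 u T x₀ → ∃ (C D K : ℝ) (v : ℝ → EuclideanSpace ℝ (Fin 3) → EuclideanSpace ℝ (Fin 3)), Literature.Analysis.FluidPDE.HasTypeITimeDecay C v ∧ Literature.Analysis.FluidPDE.HasTypeIDecay D v ∧ HasTypeIDerivDecay K v ∧ ContinuousOn (Function.uncurry v) (Set.Iio (0 : ℝ) ×ˢ Set.univ) ∧ (∀ s t : ℝ, s < t → t < 0 → ∀ x, v t x = Literature.Analysis.UnboundedOperators.heatExtension (v s) (t - s) x - Literature.Analysis.FluidPDE.oseenDuhamel 1 s v v t x) ∧ (∀ t < 0, Literature.Analysis.FluidPDE.VectorCalculus.IsDivFree (v t)) ∧ Literature.Analysis.FluidPDE.IsBackwardSingularPoint v 0 ∧ (∀ s < 0, ∃ U : Set (EuclideanSpace ℝ (Fin 3)), IsOpen U ∧ U.Nonempty ∧ ∀ z ∈ U, curl (v s) z = fracLapHalf (v s) z) :=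
  localPointZoomChiralWindow_of_noBinder localPointZoomChiralWindow_noBinder

/-- **THE DOOR S20 «ChiralWindowDoor»: target (rank 0) `Target` of nsreg-p1 `r19/Sketch20v5.lean` (text verbatim over the
tree substrate; identical in `r19/Sketch20v6.lean`), PROVED.**  A classical Leray–Hopf flow on `[0,T)` from rapidly
decaying data which is LOCALLY SPACE–TIME TYPE I at `(x₀,T)` and whose scale-normalised chirality defect
`(T−t)·(curl u − Λu)(t, x₀ + √(T−t)y)` fades in `L¹` on ONE nonempty open similarity window `U` is backward bounded at
`x₀` (K1 `localPointZoomChiralWindow` + K2 `…ChiralProfileRigidity.chiralProfileRigidity`, the planner's `closes`). -/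
theorem target : ∀ (ν T : ℝ), 0 < ν → 0 < T → ∀ (u : ℝ → EuclideanSpace ℝ (Fin 3) → EuclideanSpace ℝ (Fin 3)) (p : ℝ → EuclideanSpace ℝ (Fin 3) → ℝ), Literature.Analysis.FluidPDE.IsClassicalNSSolutionOn (Set.Ico 0 T) ν 0 u p → Literature.Analysis.FluidPDE.IsLerayHopfOn T ν 0 (u 0) u → Literature.Analysis.FluidPDE.HasRapidSpatialDecay (u 0) → ∀ (x₀ : EuclideanSpace ℝ (Fin 3)) (ρ M : ℝ), 0 < ρ → (∀ t ∈ Set.Ico 0 T, T - ρ ^ 2 < t → ∀ x ∈ Metric.ball x₀ ρ, ‖u t x‖ * (‖x - x₀‖ + Real.sqrt (ν * (T - t))) ≤ M) → ∀ (U : Set (EuclideanSpace ℝ (Fin 3))), IsOpen U → U.Nonempty → Filter.Tendsto (fun t => ∫⁻ y in U, ENNReal.ofReal ‖(T - t) • (curl (u t) (x₀ + Real.sqrt (T - t) • y) - fracLapHalf (u t) (x₀ + Real.sqrt (T - t) • y))‖) (nhdsWithin T (Set.Iio T)) (nhds 0) → Literature.Analysis.FluidPDE.IsBackwardBoundedAt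 u T x₀ :=
  target_of_K1 localPointZoomChiralWindow

end Summit.NavierStokesRegularity.NavierStokesRegularity.Theorems.ChiralWindowDoorTarget

end
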